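import Literature.AlgebraicGeometry.Surfaces.K3Surface
import Literature.AlgebraicGeometry.Motives.Sweep1
import Literature.AlgebraicGeometry.Motives.MotivatedPeriodTorsor
import Literature.AlgebraicGeometry.Motives.AbelianVarietyProjectiveChart
import Literature.AlgebraicGeometry.HodgeTheory.LefschetzStandardConjectureFacts
import Literature.AlgebraicGeometry.HodgeTheory.MotivatedClassesAssembly
import Literature.AlgebraicGeometry.HodgeTheory.ComplexConjugationHolds
import HarnessLib

/-!
# Hodge classes on products of abelian varieties, projective K3 surfaces and cubic hypersurfaces of dimension `≤ 5` are motivated (André 1996, Thm. 0.6.3 / 7.1 / 7.2 with §6.3) — NAMED FACT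

Layer `Literature/AlgebraicGeometry/Andre1996`.  CITE record owed by the Hodge-ladder stage-4 scoping
(run/shared/lean/pub/hodge-director/STAGE4-ABELIAN-MOTIVIC-TYPE.md, v1/v2 §10 "André 1996 Thm 7.1
consequence «Hodge classes on POWERS of K3 surfaces are motivated»", rows 1 and 3b): the real-carrier
shadow of the statement that the motives of projective K3 surfaces and of smooth cubic hypersurfaces of
`ℙⁿ`, `n ≤ 6`, lie in André's tannakian category `M(Ab)_𝒱` generated by abelian varieties, on which the
Betti–Hodge realisation is fully faithful.  It is the input of road (R1) of the scoping document for
rows 1 (powers and products of K3 surfaces) and 3b (powers of cubic fourfolds): together with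
Grothendieck's `B` for all smooth projective complex varieties it yields the Hodge conjecture for these
varieties through the tree's assembly
`HodgeTheory.Andre1996_motivatedClasses_le_algebraicClasses_of_standardConjectureB_holds_of`
(`hodgeConjectureFor_of_lefschetzStandardB` below) — `HC_AV` is not an input of that road.

## Source (read: held text `paper:doi-10-1007-bf02698643`, PDF pages as given)

Y. André, *Pour une théorie inconditionnelle des motifs*, Publ. Math. IHÉS **83** (1996) 5–49
[Andre1996Motifs]:
* Thm. 0.4 (p. 8): the `ℚ`-linear `⊗`-category `M(𝒱)` deduced from motivated correspondences by the
  usual construction is tannakian, graded, semisimple, polarised; every classical cohomology factors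
  through it.  §4.1–4.2 (pp. 22–23): objects `(X, q, r)`, morphisms = motivated correspondences
  `C_mot`; so `Hom_{M(𝒱)}(𝟙, h(X)(p)) = A_motᵖ(X)` (Déf. 1, §2.1 p. 14).
* §4.5 (p. 24, PDF p. 21 L1–3): "`M(𝒲)_𝒱` [est] la sous-catégorie tannakienne de `M(𝒱)` `⊗`-équivalente
  à la catégorie des motifs (non tordus) découpés sur les sommes disjointes finies de produits de copies
  de membres de `𝒲`."  §6.1 (p. 30, PDF p. 27 L30–33): "nous étudions les motifs engendrés par la famille
  `Ab` des `K`-schémas de la forme `A ×_K K'` […] Ces motifs sont aussi les objets de la catégorie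
  tannakienne `M(Ab)_𝒱` engendrée par les `h(A)` et les motifs d'Artin".
* §6.3 (p. 31, PDF p. 28 L20–24): "Nous allons démontrer le théorème 0.6.2, à savoir que tout élément `ξ`
  de type `(0, 0)` dans `H_B(A, ℚ)(p)` est motivé. En remplaçant `A` par ses puissances, on en déduit que
  `G_mot(A)` coïncide avec `G_MT(A)`. Ceci valant pour toute variété abélienne complexe, il en résulte
  que le foncteur « réalisation de Betti-Hodge » de `M(Ab)_𝒱` vers la catégorie des `ℚ`-structures de
  Hodge est pleinement fidèle."
* Thm. 0.6.3 (p. 9, PDF p. 6 L20–21): "Le motif de toute surface K3 projective et de toute hypersurface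
  cubique de `ℙⁿ`, `n ≤ 6`, est isomorphe à un motif découpé sur une variété abélienne." = Thm. 7.1
  (p. 35, PDF p. 32 L15–16): "La cohomologie motivique de toute surface K3 algébrique `Y₀` est un objet
  de `M(Ab)_𝒱`" (proof: Lemmes 7.1.1–7.1.3, the Kuga–Satake abelian scheme and an exceptional `ρ = 20`
  fibre, with Thm. 0.5) and Thm. 7.2 (p. 35, PDF p. 32 L19–20): "La cohomologie motivique de toute
  hypersurface cubique lisse `V₀` de `ℙⁿ`, `n ≤ 6`, est un objet de `M(Ab)_𝒱` (pour `𝒱` convenable)."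
  ("Les cas `n ≤ 3` sont faciles et bien connus"; `n = 5`: weight-4 Kuga–Satake, Fermat fibre; `n = 4, 6`:
  relative intermediate Jacobian; Remarque: "Le même résultat vaut pour les quartiques dans `ℙ⁴`.")

The recorded consequence, in one step from the four quotations: for `X = X₁ × ⋯ × X_k` with each `Xᵢ`
an abelian variety, a projective K3 surface or a smooth cubic hypersurface of `ℙⁿ`, `n ≤ 6`,
`h(X) = ⊗ᵢ h(Xᵢ)` is an object of the tannakian (`⊗`-stable) subcategory `M(Ab)_𝒱` (Thm. 0.6.3, §4.5,
§6.1), so by the full faithfulness of §6.3 every Hodge class in `H²ᵖ(X, ℚ)(p) = Hom_Hdg(ℚ(0), H(h²ᵖ(X)(p)))`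
comes from `Hom_{M(Ab)_𝒱}(𝟙, h²ᵖ(X)(p)) ⊆ A_motᵖ(X)`: **every Hodge class on `X` is motivated.**  The
same sentence, for hyperkähler varieties, is how Soldatenkov 2022 §2.2 quotes André ("It is shown in
[André 1996] that for any `X`, if `M(X) ∈ M_ab`, then all Hodge classes on `X` are motivated, in
particular absolute Hodge"; tree: `Hyperkaehler/HodgeClassesMotivated`).  For a single abelian variety
the consequence is Thm. 0.6.2 itself — the tree's named fact
`HodgeTheory.Andre1996_hodgeClasses_abelianVariety_motivated`, which `Andre1996/HodgeClassesMotivatedAssembly`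
assembles from Thm. 0.5 and Lemmes 6.3.1–6.3.3; the present record is the `M(Ab)_𝒱`-closure statement
(`abelianVariety_motivated_of` below makes the overlap explicit: the record implies that fact).

## Rendering (tree carriers) and faithfulness

* The class of varieties is the inductive predicate `IsAbelianTypePiece d X` ("`X` is a product of
  André's generators, of dimension `d`"): generators `Spec ℂ` (the empty product, `X⁰`), complex abelian
  varieties `A.X` (`Motives.AbelianVariety ℂ`, dimension `A.dim`), projective K3 surfaces
  (`Surfaces.IsK3Surface`, dimension `2`), smooth cubic hypersurfaces `X ⊂ ℙ^{e+1}` of dimension `e ≤ 5`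
  (`Motives.IsSmoothHypersurface e 3 X`; André's `n = e + 1 ≤ 6`), closed under the monoidal product
  `X ⊗ Y = X ×_ℂ Y` of `SchemeOver ℂ` (dimensions add).  Every such `X` is smooth projective of dimension
  `d` (`IsAbelianTypePiece.isSmoothProjective`, PROVED from the tree's theorems), and cartesian powers
  `Motives.SchemeOver.pow` of pieces are pieces (`IsAbelianTypePiece.pow`, PROVED).
  -- TODO(general form): André's `M(Ab)_𝒱` also contains the motives of Fermat hypersurfaces (§6.1
  -- Exemple 2, from [KaS79]) and of smooth quartic threefolds in `ℙ⁴` (Remarque after Thm. 7.2), and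
  -- every motive CUT OUT on these by motivated correspondences; only the generators displayed in
  -- Thm. 0.6.3 (with abelian varieties and products) are recorded — less than print, never more.
* "every Hodge class on `X` is motivated": every rational class of Hodge type `(p, p)` in
  `H²ᵖ(X(ℂ); ℂ)` lies in `HodgeTheory.motivatedClasses d X p` — André's `A_motᵖ(X)_ℂ` modelled on ALL
  smooth projective complex varieties (file `HodgeTheory/MotivatedClasses`; André's "pour `𝒱`
  convenable" asks `𝒱` to contain certain auxiliary varieties — the compactified Kuga–Satake families of
  Lemme 7.1.3, compact pencils of abelian varieties — all of which the maximal `𝒱` contains; a class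
  motivated for a smaller `𝒱` is motivated for a larger one).  Same rendering as
  `Hyperkaehler.Soldatenkov2022_hodgeClasses_motivated_K3HilbertType_or_kummerType`.

## What is NOT here

André motives as a category (the statements "`h(X) ∈ M(Ab)_𝒱`" themselves, the motivated Kuga–Satake
isomorphism); Thm. 0.6.4; any proof.  The Hodge conjecture for these varieties is NOT recorded (it is
open for powers of K3 surfaces and of cubic fourfolds); only road (R1) under `B` is derived.
-/

noncomputable section

open CategoryTheory MonoidalCategory

namespace Literature.AlgebraicGeometry.Andre1996

open Literature.AlgebraicGeometry.Motives (SchemeOver IsSmoothProjective AbelianVariety)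
open Literature.AlgebraicGeometry.HodgeTheory

/-! ### Products of André's generators of `M(Ab)_𝒱` -/

/-- **`X` is a product, of dimension `d`, of the varieties whose motive André 1996 places in `M(Ab)_𝒱`**
(Thm. 0.6.3 = Thms. 7.1–7.2, §6.1): the smallest class of complex varieties containing `Spec ℂ`, every
complex abelian variety (dimension `dim A`), every projective K3 surface (dimension `2`), every smooth
cubic hypersurface of `ℙ^{e+1}` with `e ≤ 5`, and closed under `X ×_ℂ Y` (the monoidal product of
`SchemeOver ℂ`; dimensions add).  By §4.5/§6.1 (`M(Ab)_𝒱` is the tannakian subcategory of motives cut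
out on products of abelian varieties) the motive of every such `X` is an object of `M(Ab)_𝒱`.
[cite: Andre1996Motifs, Thm. 0.6.3 (p. 9), §4.5 (p. 24), §6.1 (p. 30), Thm. 7.1 and Thm. 7.2 (p. 35)] -/
inductive IsAbelianTypePiece : ℕ → SchemeOver ℂ → Prop
  | unit : IsAbelianTypePiece 0 (𝟙_ (SchemeOver ℂ))
  | abelianVariety (A : AbelianVariety ℂ) : IsAbelianTypePiece A.dim A.X
  | k3 {S : SchemeOver ℂ} (hS : Surfaces.IsK3Surface S) : IsAbelianTypePiece 2 S
  | cubic {e : ℕ} {X : SchemeOver ℂ} (hX : Motives.IsSmoothHypersurface e 3 X) (he : e ≤ 5) :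
      IsAbelianTypePiece e X
  | tensor {m n : ℕ} {X Y : SchemeOver ℂ} (hX : IsAbelianTypePiece m X) (hY : IsAbelianTypePiece n Y) :
      IsAbelianTypePiece (m + n) (X ⊗ Y)

namespace IsAbelianTypePiece

/-- Every product of André's generators is a smooth projective (geometrically integral) complex variety
of the displayed dimension — from the tree's theorems `Motives.isSmoothProjective_unit_holds`,
`Motives.AbelianVariety.isSmoothProjective_holds`, `Surfaces.IsK3Surface.isSmoothProjective`, the first
clause of `Motives.IsSmoothHypersurface`, and `Motives.IsSmoothProjective.tensor_holds` (André's base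
pieces are "`K`-schémas projectifs lisses", §2.1; products of smooth projective varieties are smooth
projective, Hartshorne II Ex. 5.11 / III.10.1). [cite: Andre1996Motifs, §2.1 (p. 14) and §4.5 (p. 24)]
[cite: Hartshorne1977, Ch. III Prop. 10.1 and Ch. II Ex. 5.11] -/
theorem isSmoothProjective {d : ℕ} {X : SchemeOver ℂ} (h : IsAbelianTypePiece d X) :
    IsSmoothProjective d X := by
  induction h with
  | unit => exact Motives.isSmoothProjective_unit_holds ℂ
  | abelianVariety A => exact Motives.AbelianVariety.isSmoothProjective_holds
  | k3 hS => exact hS.isSmoothProjective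
  | cubic hX _ => exact hX.1
  | tensor _ _ ihX ihY => exact Motives.IsSmoothProjective.tensor_holds ihX ihY

/-- Cartesian powers `Xᵐ` (`Motives.SchemeOver.pow`: `X⁰ = Spec ℂ`, `X^{m+1} = Xᵐ ×_ℂ X`) of a product
of generators are products of generators, of dimension `m * d` ("produits de copies de membres de `𝒲`",
§4.5). [cite: Andre1996Motifs, §4.5 (p. 24)] -/
theorem pow {d : ℕ} {X : SchemeOver ℂ} (h : IsAbelianTypePiece d X) :
    ∀ m : ℕ, IsAbelianTypePiece (m * d) (X.pow m)
  | 0 => by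
    rw [Nat.zero_mul]
    exact unit
  | m + 1 => by
    rw [Nat.succ_mul]
    exact tensor (pow h m) h

/-- Powers `Sᵐ` of a projective K3 surface, dimension `m * 2` (the carrier of the stage-4 row-1 target
`HC_K3Powers`). [cite: Andre1996Motifs, Thm. 7.1 (p. 35)] -/
theorem k3_pow {S : SchemeOver ℂ} (hS : Surfaces.IsK3Surface S) (m : ℕ) :
    IsAbelianTypePiece (m * 2) (S.pow m) :=
  (k3 hS).pow m

/-- Products `S ×_ℂ S'` of two projective K3 surfaces, dimension `4` (the carrier of the stage-4 row-1
target `HC_K3Pairs`). [cite: Andre1996Motifs, Thm. 7.1 (p. 35)] -/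
theorem k3_tensor_k3 {S S' : SchemeOver ℂ} (hS : Surfaces.IsK3Surface S)
    (hS' : Surfaces.IsK3Surface S') : IsAbelianTypePiece 4 (S ⊗ S') :=
  tensor (k3 hS) (k3 hS')

/-- Powers `Xᵐ` of a smooth cubic fourfold `X ⊂ ℙ⁵`, dimension `m * 4` (the carrier of the stage-4
row-3b target `HC_CubicFourfoldPowers`; André's case `n = 5`). [cite: Andre1996Motifs, Thm. 7.2 (p. 35)] -/
theorem cubicFourfold_pow {X : SchemeOver ℂ} (hX : Motives.IsSmoothHypersurface 4 3 X) (m : ℕ) :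
    IsAbelianTypePiece (m * 4) (X.pow m) :=
  (cubic hX (by norm_num)).pow m

/-- A projective K3 surface times an abelian variety, dimension `2 + dim A` (row 1 of the scoping
document: "K3 × abelian"). [cite: Andre1996Motifs, Thm. 7.1 (p. 35) and §6.1 (p. 30)] -/
theorem k3_tensor_abelianVariety {S : SchemeOver ℂ} (hS : Surfaces.IsK3Surface S)
    (A : AbelianVariety ℂ) : IsAbelianTypePiece (2 + A.dim) (S ⊗ A.X) :=
  tensor (k3 hS) (abelianVariety A)

end IsAbelianTypePiece

/-! ### The named fact -/

/-- **André 1996 (Thm. 0.6.3 / 7.1 / 7.2 with §4.5, §6.1 and the full faithfulness of §6.3): every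
Hodge class on a product of complex abelian varieties, projective K3 surfaces and smooth cubic
hypersurfaces of `ℙⁿ`, `n ≤ 6`, is MOTIVATED.**  Printed ingredients (verbatim in the module docstring):
the motive of each generator is an object of the tannakian subcategory `M(Ab)_𝒱` of André motives
generated by abelian varieties (Thm. 0.6.3, p. 9; Thms. 7.1–7.2, p. 35; §6.1, p. 30), `M(Ab)_𝒱` is
`⊗`-stable (§4.5, p. 24), and the Betti–Hodge realisation restricted to `M(Ab)_𝒱` is fully faithful
(§6.3, p. 31), so Hodge classes `= Hom_Hdg(ℚ(0), H²ᵖ(X)(p))` come from `Hom(𝟙, h²ᵖ(X)(p)) ⊆ A_motᵖ(X)`.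
Rendering (module docstring): for `X` with `IsAbelianTypePiece d X`, every rational class
`c ∈ H²ᵖ(X(ℂ); ℂ)` of Hodge type `(p, p)` lies in André's `motivatedClasses d X p` (modelled on all
smooth projective complex varieties).  For a single abelian variety this is Thm. 0.6.2
(`HodgeTheory.Andre1996_hodgeClasses_abelianVariety_motivated`, implied: `abelianVariety_motivated_of`).
A THEOREM in print, unproved in the tree. [cite: Andre1996Motifs, Thm. 0.6.3 (p. 9), §6.3 (p. 31), §4.5 (p. 24), Thm. 7.1 and Thm. 7.2 (p. 35)]
[cite: Soldatenkov2022, §2.2] -/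
def Andre1996_hodgeClasses_motivated_of_isAbelianTypePiece : Prop :=
  ∀ ⦃d : ℕ⦄ ⦃X : SchemeOver ℂ⦄, IsAbelianTypePiece d X →
    ∀ (p : ℕ) (c : complexBetti X (2 * p)), IsRationalClass c → IsOfHodgeType d X (2 * p) p p c →
      c ∈ motivatedClasses d X p

namespace Andre1996_hodgeClasses_motivated_of_isAbelianTypePiece

/-- The generator case `X = A` an abelian variety is André's Thm. 0.6.2: the record implies the tree's
named fact `HodgeTheory.Andre1996_hodgeClasses_abelianVariety_motivated` (whose own assembly from
Thm. 0.5 and Lemmes 6.3.1–6.3.3 is `Andre1996/HodgeClassesMotivatedAssembly`).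
[cite: Andre1996Motifs, Thm. 0.6.2 (p. 9)] -/
theorem abelianVariety_motivated_of (h : Andre1996_hodgeClasses_motivated_of_isAbelianTypePiece) :
    Andre1996_hodgeClasses_abelianVariety_motivated :=
  fun A _ p c hc hpp ↦ h (IsAbelianTypePiece.abelianVariety A) p c hc hpp

/-- Powers of a projective K3 surface: every rational `(p,p)`-class on `Sᵐ` is motivated (the v1 §10
"CITE OWED" sentence of the stage-4 scoping document). [cite: Andre1996Motifs, Thm. 7.1 (p. 35) and §6.3 (p. 31)] -/
theorem k3_pow (h : Andre1996_hodgeClasses_motivated_of_isAbelianTypePiece) {S : SchemeOver ℂ}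
    (hS : Surfaces.IsK3Surface S) (m p : ℕ) (c : complexBetti (S.pow m) (2 * p))
    (hc : IsRationalClass c) (hpp : IsOfHodgeType (m * 2) (S.pow m) (2 * p) p p c) :
    c ∈ motivatedClasses (m * 2) (S.pow m) p :=
  h (IsAbelianTypePiece.k3_pow hS m) p c hc hpp

/-- **Consequence (André 1996, Prop. 2.5.1): Hodge classes on products of André's generators are
ABSOLUTE HODGE** — the record composed with the tree's named fact
`HodgeTheory.Andre1996_isAbsoluteHodgeClass_of_mem_motivatedClasses` (rational motivated classes are
absolute Hodge), exactly as Soldatenkov 2022 Cor. 1.3 is derived in `Hyperkaehler/HodgeClassesMotivated`.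
[cite: Andre1996Motifs, Prop. 2.5.1 (p. 18)] [cite: Soldatenkov2022, §2.2] -/
theorem hodgeClasses_absoluteHodge_of (h : Andre1996_hodgeClasses_motivated_of_isAbelianTypePiece)
    (hA : Andre1996_isAbsoluteHodgeClass_of_mem_motivatedClasses) {d : ℕ} {X : SchemeOver ℂ}
    (hX : IsAbelianTypePiece d X) (p : ℕ) (c : complexBetti X (2 * p)) (hc : IsRationalClass c)
    (hpp : IsOfHodgeType d X (2 * p) p p c) : IsAbsoluteHodgeClass d X p c :=
  hA hX.isSmoothProjective p c hc (h hX p c hc hpp)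

/-- **Road (R1) of the stage-4 scoping for rows 1 and 3b, kernel-typed: Grothendieck's `B`
(algebraicity of `*_L`, the tree's `StandardConjectureBStar`) for ALL smooth projective complex varieties
⟹ the tree's per-variety Hodge statement for every product of André's generators** (all powers and
products of projective K3 surfaces, powers of cubic fourfolds, K3 × abelian, …), GIVEN this file's
record (Hodge ⟹ motivated on such `X`) and the multiplicativity of algebraic classes
(`HodgeTheory.Voisin2003_cupProduct_algebraicClasses`, Voisin II Prop. 9.20): under `B`, motivated ⊆
algebraic by the tree's PROVED assembly (André §0.3 / §2.1); Hodge models exist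
(`HodgeTheory.nonempty_hodgeModel_holds`).  Algebraicity of Hodge classes on abelian varieties (`HC_AV`)
is NOT an input of this road. [cite: Andre1996Motifs, §0.3 (p. 7) and §2.1 remark following Déf. 1 (p. 14)] -/
theorem hodgeConjectureFor_of_lefschetzStandardB
    (h : Andre1996_hodgeClasses_motivated_of_isAbelianTypePiece)
    (hcup : Voisin2003_cupProduct_algebraicClasses)
    (hB : ∀ (d : ℕ) (Z : SchemeOver ℂ) (η : complexBetti Z 2),
      IsSmoothProjective d Z → StandardConjectureBStar d Z η)
    {d : ℕ} {X : SchemeOver ℂ} (hX : IsAbelianTypePiece d X) : HodgeConjectureFor d X :=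
  ⟨nonempty_hodgeModel_holds hX.isSmoothProjective, fun p c hc hpp ↦
    Andre1996_motivatedClasses_le_algebraicClasses_of_standardConjectureB_holds_of hcup hB
      hX.isSmoothProjective p (h hX p c hc hpp)⟩

end Andre1996_hodgeClasses_motivated_of_isAbelianTypePiece

end Literature.AlgebraicGeometry.Andre1996

end
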